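import Literature.NumberTheory.GaloisRepresentations.LubinTateReciprocity
import Literature.NumberTheory.GaloisRepresentations.LubinTateUnramifiedFrobenius
import Literature.NumberTheory.GaloisRepresentations.FundamentalCharacterCyclotomicProofs
import Literature.NumberTheory.GaloisRepresentations.LubinTateComparisonUnramified
import HarnessLib

/-!
# The Lubin–Tate character reduces to the level-one fundamental character on inertia
# (`χ_π(σ) mod π = θ_{q−1}(σ)`; Serre 1972 §1.7 Prop. 3 with Lubin–Tate 1965 Thm. 3)

Route `SignedLowerHalves`, child L `SmallImageLowerHalfBothSigns` (item stmt-BirchSwinnertonDyer-23599), line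
proposal `rtt_w3`, stub K0₂@p `stub_heckeThetaPartner_ns` — brick AH5/S5 ("LT reduction") of the arithmetic half
at an ODD prime (width seat `bsd-line-slh-p3-w3` gen 9; memo `Lines/birth_acns-MEMO-w3-g9.md`).  THEOREMS ONLY
(no definition, no named fact, no `sorry`); ROUTE-INDEPENDENT; purely LOCAL.

For a non-archimedean local field `F` with uniformiser `π` (`q = #𝓀_F`), the Lubin–Tate character
`χ_π : Γ_F → 𝒪_Fˣ` of `f = πX + X^q` (tree `lubinTateChar`: `σ λ = [χ_π(σ)]_f λ` on all division points) and
the Kummer character `θ_{q−1}` of `π` (tree `fundamentalCharacter F 1 ι π` = the LEVEL-ONE fundamental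
character, `σ ↦ σ(z)/z mod 𝔓` for any `z` with `‖z‖^{q−1} = ‖π‖`, `coe_kummerCharacter_eq_residue_smul_div`)
satisfy, for every `σ` in the inertia group of `F`:

  `θ_{q−1}(σ) = ι(χ_π(σ) mod 𝔓)`  (`fundamentalCharacter_one_eq_residue_lubinTateChar`).

Proof: take `z = λ₁`, the first division point (`genPt hπ 0`; `λ₁^{q−1} = −π`, so `‖λ₁‖^{q−1} = ‖π‖`); then
`σλ₁ = [χ_π(σ)]_f λ₁` (`absGal_smul_ltRoot`) and `[u]_f λ₁ = uλ₁ + λ₁²·s` with `‖s‖ ≤ 1` (the series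
`[u]_f = uX + X²g`, `coeff_one_hom`), whence `σλ₁/λ₁ = u + λ₁ s ≡ u (mod 𝔓)`.

With Lubin–Tate reciprocity (`coe_lubinTateChar_toAbsGalois`: `χ_π(w) = Art(w)` on inertia) this says: the
level-one fundamental character on the inertia of the Weil group IS the reduction of the Artin map,
`θ_{q−1}(w) = ι(Art(w) mod 𝔓)` (`fundamentalCharacter_one_eq_residue_artin`) — the local input of the
ORIENTATION of the CM theta partner at the inert prime `𝔭` of the dihedral field (`K_𝔭 ≅ ℚ_{p²}`, `q = p²`,
`θ_{q−1}` = the exponent-`(p²−1)` Kummer character of `p` of brick S1).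

BSD, crux L and the stub are NOT proved here.

References: J.-P. Serre, Invent. Math. 15 (1972) §1.7 Prop. 3 ("`θ_{q−1}` et la théorie du corps de classes
local"); J. Lubin, J. Tate, Ann. of Math. 81 (1965) Thm. 3; Cassels–Fröhlich Ch. VI §3.4, §3.7.
-/

set_option autoImplicit false
set_option linter.dupNamespace false

noncomputable section

open Filter Topology Polynomial

namespace Summit.BirchSwinnertonDyer.BirchSwinnertonDyer.Theorems.SmallImageLambdaLowerThreeNsThetaPartner

open ValuativeRel Field Literature.NumberTheory.GaloisRepresentations
  Literature.NumberTheory.GaloisRepresentations.IsNonarchimedeanLocalField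
  Literature.NumberTheory.GaloisRepresentations.LubinTate

/-! ### §1. A constant-term-free power series is `h₁ X + X² g` -/

section Series

variable {A : Type*} [CommRing A]

/-- `h = h₁·X + X²·g` for a power series `h` without constant term. [folklore] -/
theorem exists_eq_C_mul_X_add_X_sq_mul (h : PowerSeries A) (hh : PowerSeries.constantCoeff h = 0) :
    ∃ g : PowerSeries A, h = PowerSeries.C (PowerSeries.coeff 1 h) * PowerSeries.X + PowerSeries.X ^ 2 * g := by
  obtain ⟨h₁, rfl⟩ := PowerSeries.X_dvd_iff.mpr hh
  have h1 : PowerSeries.coeff 1 (PowerSeries.X * h₁) = PowerSeries.constantCoeff h₁ := by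
    rw [show (1 : ℕ) = 0 + 1 from rfl, PowerSeries.coeff_succ_X_mul, PowerSeries.coeff_zero_eq_constantCoeff]
  obtain ⟨g, hg⟩ := PowerSeries.X_dvd_iff.mpr
    (show PowerSeries.constantCoeff (h₁ - PowerSeries.C (PowerSeries.constantCoeff h₁)) = 0 by simp)
  refine ⟨g, ?_⟩
  rw [h1]
  calc PowerSeries.X * h₁
      = PowerSeries.X * (PowerSeries.C (PowerSeries.constantCoeff h₁) +
          (h₁ - PowerSeries.C (PowerSeries.constantCoeff h₁))) := by ring
    _ = _ := by rw [hg]; ring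

/-- Evaluation of `h = h₁ X + X² g` at a topologically nilpotent `x`: `h(x) = h₁ x + x² g(x)`. [folklore] -/
theorem aeval_eq_of_eq_C_mul_X_add [UniformSpace A] [DiscreteUniformity A] {S : Type*} [CommRing S] [UniformSpace S]
    [IsUniformAddGroup S] [IsTopologicalRing S] [IsLinearTopology S S] [T2Space S] [CompleteSpace S]
    [Algebra A S] [ContinuousSMul A S]
    {x : S} (hx : IsTopologicallyNilpotent x) {h g : PowerSeries A} {c : A}
    (hhg : h = PowerSeries.C c * PowerSeries.X + PowerSeries.X ^ 2 * g) :
    PowerSeries.aeval hx h = algebraMap A S c * x + x ^ 2 * PowerSeries.aeval hx g := by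
  have h1 : PowerSeries.C c * PowerSeries.X = ((Polynomial.C c * Polynomial.X : Polynomial A) : PowerSeries A) := by
    rw [Polynomial.coe_mul, Polynomial.coe_C, Polynomial.coe_X]
  have h2 : (PowerSeries.X : PowerSeries A) ^ 2 = ((Polynomial.X ^ 2 : Polynomial A) : PowerSeries A) := by
    rw [Polynomial.coe_pow, Polynomial.coe_X]
  rw [hhg, h1, h2, map_add, map_mul, PowerSeries.aeval_coe, PowerSeries.aeval_coe, Polynomial.aeval_mul,
    Polynomial.aeval_C, Polynomial.aeval_X, map_pow, Polynomial.aeval_X]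

end Series

/-! ### §2. `[u]_f λ = u λ + λ² s` and `χ_π mod π = θ_{q−1}` -/

section Local

variable {F : Type} [Field F] [ValuativeRel F] [TopologicalSpace F] [IsNonarchimedeanLocalField F]

-- The normed-field structures on `F` and on the finite subextensions of `F̄` declared (as local instances) in
-- `LubinTateTorsion.lean` / `LubinTateCharacter.lean`, re-activated verbatim (nothing is declared here).
attribute [local instance] Literature.NumberTheory.GaloisRepresentations.instUniformSpace_literature
  Literature.NumberTheory.GaloisRepresentations.rk1 Literature.NumberTheory.GaloisRepresentations.nF
  Literature.NumberTheory.GaloisRepresentations.nE Literature.NumberTheory.GaloisRepresentations.ltCharIsUniformAddGroup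

variable {π : 𝒪[F]} (hπ : (valuation F).IsUniformizer (π : F))

/-- **First-order expansion of the Lubin–Tate action**: `[u]_f x = u·x + x²·s` with `s ∈ 𝒪_E`, for every
point `x` of `𝔪_{K_π^{n+1}}` and `u ∈ 𝒪_F` (the series `[u]_f = uX + X²g` has integral coefficients).
[cite: CasselsFrohlichANT1967, Ch. VI §3.4] [cite: LubinTate1965, §1 Thm. 1 (11)] -/
theorem exists_coe_ltAct_eq (n : ℕ) (u : 𝒪[F]) (x : (maxNilIdeal F (ltField π n)).toIdeal) :
    ∃ s : unitBall (ltField π n),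
      (ltAct hπ n u x : unitBall (ltField π n)) =
        algebraMap 𝒪[F] (unitBall (ltField π n)) u * (x : unitBall (ltField π n)) +
          (x : unitBall (ltField π n)) ^ 2 * s := by
  set h := hom (isLTRing_LTCoeff hπ) (isLTSeries_LTCoeff π) (isLTSeries_LTCoeff π) (LTCoeff.of F u) with hh
  obtain ⟨g, hg⟩ := exists_eq_C_mul_X_add_X_sq_mul h
    (constantCoeff_hom (isLTRing_LTCoeff hπ) (isLTSeries_LTCoeff π) (isLTSeries_LTCoeff π) (LTCoeff.of F u))
  rw [coeff_one_hom] at hg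
  refine ⟨PowerSeries.aeval ((maxNilIdeal F (ltField π n)).isTopologicallyNilpotent _ x.2) g, ?_⟩
  change (evalPt₁ (maxNilIdeal F (ltField π n)) h
    (constantCoeff_hom (isLTRing_LTCoeff hπ) (isLTSeries_LTCoeff π) (isLTSeries_LTCoeff π) (LTCoeff.of F u)) x :
      unitBall (ltField π n)) = _
  rw [coe_evalPt₁, aeval_eq_of_eq_C_mul_X_add _ hg]
  exact rfl

/-- The same read in `F̄`: `[u]_f x = u·x + x²·s`. [cite: CasselsFrohlichANT1967, Ch. VI §3.4] -/
theorem exists_coe_ltAct_eq_algebraicClosure (n : ℕ) (u : 𝒪[F]) (x : (maxNilIdeal F (ltField π n)).toIdeal) :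
    ∃ s : unitBall (ltField π n),
      ((((ltAct hπ n u x : unitBall (ltField π n)) : ltField π n) : AlgebraicClosure F)) =
        algebraMap 𝒪[F] (AlgebraicClosure F) u * (((x : unitBall (ltField π n)) : ltField π n) : AlgebraicClosure F) +
          (((x : unitBall (ltField π n)) : ltField π n) : AlgebraicClosure F) ^ 2 *
            (((s : ltField π n)) : AlgebraicClosure F) := by
  obtain ⟨s, hs⟩ := exists_coe_ltAct_eq hπ n u x
  refine ⟨s, ?_⟩
  have hcoe : (((algebraMap 𝒪[F] (unitBall (ltField π n)) u : unitBall (ltField π n)) : ltField π n) :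
      AlgebraicClosure F) = algebraMap 𝒪[F] (AlgebraicClosure F) u := by
    rw [algebraMap_integer_apply, IsScalarTower.algebraMap_apply 𝒪[F] F (AlgebraicClosure F)]
    rfl
  rw [hs, ← hcoe]
  simp only [Subring.coe_add, Subring.coe_mul, SubmonoidClass.coe_pow, IntermediateField.coe_add,
    IntermediateField.coe_mul]

/-- `‖·‖` on `𝒪_E ⊆ E ⊆ F̄` is `algNorm`, so elements of `𝒪_E` have `algNorm ≤ 1` and points of `𝔪_E` have
`algNorm < 1`. [folklore] -/
theorem algNorm_coe_unitBall_le_one {E : IntermediateField F (AlgebraicClosure F)} [FiniteDimensional F E]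
    (s : unitBall E) : algNorm F (((s : E)) : AlgebraicClosure F) ≤ 1 := by
  rw [← norm_coe_eq_algNorm]
  exact (mem_unitBall_iff E).mp s.2

/-- Points of `𝔪_E` have `algNorm < 1`. [folklore] -/
theorem algNorm_coe_maxNilIdeal_lt_one {E : IntermediateField F (AlgebraicClosure F)} [FiniteDimensional F E]
    (x : (maxNilIdeal F E).toIdeal) : algNorm F ((((x : unitBall E)) : E) : AlgebraicClosure F) < 1 := by
  rw [← norm_coe_eq_algNorm]
  exact x.2

/-- **`[u]_f λ / λ ≡ u (mod 𝔓)`** for a NON-ZERO point `λ` of `𝔪_{K_π^{n+1}}` and `u ∈ 𝒪_F`.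
[cite: CasselsFrohlichANT1967, Ch. VI §3.4] [cite: SerreInventiones1972, §1.7 Prop. 3] -/
theorem residue_coe_ltAct_div_eq (n : ℕ) (u : 𝒪[F]) (x : (maxNilIdeal F (ltField π n)).toIdeal)
    (hx : (((x : unitBall (ltField π n)) : ltField π n) : AlgebraicClosure F) ≠ 0) :
    residue F ((((ltAct hπ n u x : unitBall (ltField π n)) : ltField π n) : AlgebraicClosure F) /
        (((x : unitBall (ltField π n)) : ltField π n) : AlgebraicClosure F)) =
      residue F (algebraMap 𝒪[F] (AlgebraicClosure F) u) := by
  obtain ⟨s, hs⟩ := exists_coe_ltAct_eq_algebraicClosure hπ n u x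
  set X : AlgebraicClosure F := (((x : unitBall (ltField π n)) : ltField π n) : AlgebraicClosure F) with hX
  set U : AlgebraicClosure F := algebraMap 𝒪[F] (AlgebraicClosure F) u with hU
  set Sv : AlgebraicClosure F := ((s : ltField π n) : AlgebraicClosure F) with hSv
  have hdiv : (U * X + X ^ 2 * Sv) / X = U + X * Sv := by rw [div_eq_iff hx]; ring
  rw [hs, hdiv]
  have hU1 : algNorm F U ≤ 1 := by
    have hcoe : (((algebraMap 𝒪[F] (unitBall (ltField π n)) u : unitBall (ltField π n)) : ltField π n) :
        AlgebraicClosure F) = U := by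
      rw [hU, algebraMap_integer_apply, IsScalarTower.algebraMap_apply 𝒪[F] F (AlgebraicClosure F)]
      rfl
    rw [← hcoe]
    exact algNorm_coe_unitBall_le_one (algebraMap 𝒪[F] (unitBall (ltField π n)) u)
  have hXS : algNorm F (X * Sv) < 1 := by
    rw [algNorm_mul]
    calc algNorm F X * algNorm F Sv ≤ algNorm F X * 1 := by
          gcongr
          · exact algNorm_nonneg _
          · exact algNorm_coe_unitBall_le_one s
      _ < 1 := by rw [mul_one]; exact algNorm_coe_maxNilIdeal_lt_one x
  rw [residue_add hU1 hXS.le, (residue_eq_zero_iff hXS.le).mpr hXS, add_zero]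

/-- The first division point `λ₁ ≠ 0` and `‖λ₁‖^{q−1} = ‖π‖` (`λ₁^{q−1} = −π`).
[cite: CasselsFrohlichANT1967, Ch. VI §3.6 Prop. 6 (proof)] -/
theorem coe_genPt_zero_ne_zero_and_algNorm_pow :
    (((genPt hπ 0 : unitBall (ltField π 0)) : ltField π 0) : AlgebraicClosure F) ≠ 0 ∧
      algNorm F ((((genPt hπ 0 : unitBall (ltField π 0)) : ltField π 0) : AlgebraicClosure F)) ^
          (residueFieldCard F - 1) =
        algNorm F (algebraMap 𝒪[F] (AlgebraicClosure F) π) := by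
  have hpow := aeval_gen_ltPolyIter_pow (F := F) (π := π) hπ 0
  rw [ltPolyIter_zero, Polynomial.map_X, Polynomial.aeval_X] at hpow
  have hgen : (((genPt hπ 0 : unitBall (ltField π 0)) : ltField π 0) : AlgebraicClosure F) =
      ((IntermediateField.AdjoinSimple.gen F (ltRoot π 0) : ltField π 0) : AlgebraicClosure F) := rfl
  have hpow' : (((genPt hπ 0 : unitBall (ltField π 0)) : ltField π 0) : AlgebraicClosure F) ^
      (residueFieldCard F - 1) = -(algebraMap 𝒪[F] (AlgebraicClosure F) π) := by
    rw [hgen, ← IntermediateField.coe_pow, hpow, IntermediateField.coe_neg,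
      IsScalarTower.algebraMap_apply 𝒪[F] F (AlgebraicClosure F)]
    rfl
  have hπ0 : algebraMap 𝒪[F] (AlgebraicClosure F) π ≠ 0 := by
    rw [IsScalarTower.algebraMap_apply 𝒪[F] F (AlgebraicClosure F),
      _root_.map_ne_zero (algebraMap F (AlgebraicClosure F))]
    exact hπ.ne_zero
  refine ⟨fun h0 => ?_, ?_⟩
  · have hq : residueFieldCard F - 1 ≠ 0 := by
      have h := residueFieldCard_pow_sub_one_pos F one_ne_zero
      rw [pow_one] at h
      exact h.ne'
    rw [h0, zero_pow hq, eq_comm, neg_eq_zero] at hpow'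
    exact hπ0 hpow'
  · rw [← algNorm_pow, hpow', algNorm_neg]

/-- **`χ_π ≡ θ_{q−1}` on inertia** (Serre 1972 §1.7 Prop. 3 ∕ Lubin–Tate): for `σ` in the inertia group of
`F`, the level-one fundamental character `ψ₁ = θ_{q−1}` (Kummer character of the uniformiser `π`, read in `k`
along the residue embedding `ι`) is the reduction of the Lubin–Tate character: `ψ₁(σ) = ι(χ_π(σ) mod 𝔓)`.
[cite: SerreInventiones1972, §1.7 Prop. 3] [cite: LubinTate1965, Thm. 3] -/
theorem fundamentalCharacter_one_eq_residue_lubinTateChar {k : Type} [Field k]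
    (ι : absIntegers 𝒪[F] F ⧸ absMaximalIdeal F →+* k) (σ : absInertia F) :
    (fundamentalCharacter F 1 ι π (irreducible_of_isUniformizer' hπ) σ : k) =
      ι (residue F (algebraMap 𝒪[F] (AlgebraicClosure F) (lubinTateChar hπ σ : 𝒪[F]))) := by
  obtain ⟨hgen0, hnorm⟩ := coe_genPt_zero_ne_zero_and_algNorm_pow hπ
  have hn : 0 < residueFieldCard F ^ 1 - 1 := residueFieldCard_pow_sub_one_pos F one_ne_zero
  have hnorm' : algNorm F ((((genPt hπ 0 : unitBall (ltField π 0)) : ltField π 0) : AlgebraicClosure F)) ^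
      (residueFieldCard F ^ 1 - 1) = algNorm F (algebraMap 𝒪[F] (AlgebraicClosure F) π) := by
    rw [pow_one]; exact hnorm
  rw [fundamentalCharacter_of_ne_zero F one_ne_zero,
    coe_kummerCharacter_eq_residue_smul_div hn (irreducible_of_isUniformizer' hπ).ne_zero ι σ hnorm']
  congr 1
  -- `σ λ₁ = [χ_π(σ)] λ₁`
  have hsmul : (σ : absoluteGaloisGroup F) •
      ((((genPt hπ 0 : unitBall (ltField π 0)) : ltField π 0) : AlgebraicClosure F)) =
      (((ltAct hπ 0 (lubinTateChar hπ σ : 𝒪[F]) (genPt hπ 0) : unitBall (ltField π 0)) :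
        ltField π 0) : AlgebraicClosure F) :=
    absGal_smul_ltRoot hπ (σ : absoluteGaloisGroup F) 0
  rw [hsmul]
  exact residue_coe_ltAct_div_eq hπ 0 _ _ hgen0

variable {art : WeilGroup F →* Fˣ} (hart : IsLocalArtinMap F art)

include hart in
/-- **The level-one fundamental character is the reduction of the local Artin map on inertia**:
`ψ₁(w) = ι(Art(w) mod 𝔓)` for `w` in the inertia subgroup of the Weil group (tree normalisation of `Art`;
`χ_π(w) = Art(w)` by Lubin–Tate reciprocity `coe_lubinTateChar_toAbsGalois`).  This is the local input of
the ORIENTATION of the CM theta partner at an inert prime.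
[cite: SerreInventiones1972, §1.7 Prop. 3] [cite: LubinTate1965, Thm. 3 and Cor.] -/
theorem fundamentalCharacter_one_eq_residue_artin {k : Type} [Field k]
    (ι : absIntegers 𝒪[F] F ⧸ absMaximalIdeal F →+* k) {w : WeilGroup F} (hw : w ∈ WeilGroup.inertia F)
    (hwI : WeilGroup.toAbsGalois F w ∈ absInertia F) :
    (fundamentalCharacter F 1 ι π (irreducible_of_isUniformizer' hπ) ⟨WeilGroup.toAbsGalois F w, hwI⟩ : k) =
      ι (residue F (algebraMap F (AlgebraicClosure F) (art w : F))) := by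
  rw [fundamentalCharacter_one_eq_residue_lubinTateChar hπ ι ⟨WeilGroup.toAbsGalois F w, hwI⟩]
  congr 2
  rw [IsScalarTower.algebraMap_apply 𝒪[F] F (AlgebraicClosure F)]
  congr 1
  exact coe_lubinTateChar_toAbsGalois hπ hart hw

end Local

end Summit.BirchSwinnertonDyer.BirchSwinnertonDyer.Theorems.SmallImageLambdaLowerThreeNsThetaPartner

end
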